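import Summits.QuantumAdvantage.AdviceFreeQNC0.R1OneFibre39
import HarnessLib

/-!
# Cell qa-qnc0, `p = 3` — the kernel-line fibre method WITH AN EXTRA REAL SIGN CHARACTER; the typed conjectures `SparseRead39.
# TwistBoundZConstPM` / `TwistBoundZConstPMWeak` (planner qa-qnc0-p1 g39, ROUND-38 §6.4.2, ask A39-6) PROVED (prover qn-prover-3 g26)

`SparseRead39.lean` (planner p1 g39) typed the SPARSE-READING rung of (R1) on a twist bound for constant-output strategies that tolerates
an extra real sign character `(−1)^{Σ_{i ∈ σ} x_i}` (`TwistBoundZConstPM ρ`, "conjectured for some `ρ < 1`"; `sparseRead_of_pm` there derives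
`SparseReadTwistBound ρ` from it).  This file proves it — indeed the whole TRANSVERSAL FORM of (R1) (`R1OneFibre39`, qn-prover-3 g25) with
the extra sign — by the fibre method of planner qa-qnc0-p1 g22: on the fibre of a kernel line the sign character is one more `±1` COORDINATE
PRODUCT of the coins (`isCoordProduct_sgn_fibre`), so LEMMA JPD (`AffBells23.norm_sum_juntaProduct_mul_char_le`) applies verbatim with
`Ψ₀ := Ψ₀ · sgn σ`; every twisted transversal coin still contributes `‖±1 ± ω^{±1}‖ ≤ √3`.

* `AffBells22.norm_fibre_twist_le_junta_signed`, `norm_twist_sum_le_junta_signed`, `norm_oddClass_char_le_signed`,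
  **`norm_twistedWinSum_le_of_transversal_signed`** (`‖Σ_x e₃(β·x)·sgn_σ(x)·[OddZeros x ∧ Rel x (g x)]‖ ≤ 2·(39/40)^{#A}·2^N`, `N ≥ 3`,
  bell `k` reads `T k`, `#(T k ∩ A) ≤ 1`, `A ⊆ supp β`);
* **`SparseRead39.twistBoundZConstPM : TwistBoundZConstPM (39/40)`** (`A = 2`), `twistBoundZConstPMWeak`, `sparseReadTwistBound`,
  `sparseReadTwistBoundOff` — the four statements of `SparseRead39.lean` (ROUND-38 §6.4.2), now unconditional; `norm_twSum_le_of_transversal`,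
  `norm_twSum_le_of_determined_sharp` (the signed `(R1)₀` WITHOUT the `2^{#R}` loss).

WHAT THIS IS NOT: (R1) for `C ≥ 1` with densely overlapping outside reads is untouched; crux `stmt-QuantumAdvantage-22907` untouched.
-/

noncomputable section

namespace Summit.QuantumAdvantage.AdviceFreeQNC0

open Finset Literature.Computability.QuantumComplexity Literature.Computability.QuantumComplexity.RingHLF
open Literature.Computability.MetaComplexity
open scoped Classical

namespace AffBells22

variable {N : ℕ}

/-! ## The sign character on the cube and on a fibre -/

/-- Reading the conjunction `σ_i ∧ x_i` of one fixed bit. -/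
theorem readsOnly_and_apply (c : Bool) (b : Fin N) : ReadsOnly {b} (fun x : Fin N → Bool => c && x b) :=
  fun _ _ h => congrArg (fun d : Bool => c && d) (h b (mem_singleton_self b))

/-- The real sign character `sgn σ x = Π_i (−1)^{[σ_i ∧ x_i]}` as a product of `sgnB`'s. -/
theorem sgn_eq_prod_sgnB (σ x : Fin N → Bool) : SparseRead39.sgn σ x = ∏ i : Fin N, sgnB (σ i && x i) := rfl

/-- The sign character is a coordinate product on the full cube. -/
theorem isCoordProduct_sgn_cube (σ : Fin N → Bool) :
    IsCoordProduct (fun x : Fin N → Bool => SparseRead39.sgn σ x) := by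
  simp_rw [sgn_eq_prod_sgnB]
  exact isCoordProduct_prod _ _ fun i _ => isCoordProduct_single i (fun b => sgnB (σ i && b)) (fun b => sgnB_cases _)

/-- **The sign character on the fibre of a kernel line is a coordinate product of the coins** (forced bits give constants). -/
theorem isCoordProduct_sgn_fibre (J : Fin N → Bool) (σ : Fin N → Bool) :
    IsCoordProduct (fun v : {i // i ∉ act J} → Bool => SparseRead39.sgn σ (gv J v)) := by
  simp_rw [sgn_eq_prod_sgnB]
  exact isCoordProduct_prod _ _ fun i _ =>
    isCoordProduct_sgnB_reader J {i} (by simp) (fun x => σ i && x i) (readsOnly_and_apply (σ i) i)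

/-- `‖sgn σ x‖ = 1`. -/
theorem norm_sgn (σ x : Fin N → Bool) : ‖SparseRead39.sgn σ x‖ = 1 := by
  rw [sgn_eq_prod_sgnB, norm_prod]
  exact prod_eq_one fun i _ => by rcases sgnB_cases (σ i && x i) with h | h <;> simp [h]

/-! ## The signed per-fibre twist bound -/

/-- **SIGNED PER-FIBRE TWIST BOUND, JUNTA TABLES**: for tables `y_k` reading `T_k`, a sign pattern `σ` and a TRANSVERSAL `A` of `(T_k)`,
`‖Σ_{x odd, J(x) = J} (−1)^{⟨J, stake(y,x)⟩} sgn_σ(x) ω^{⟨γ,x⟩}‖ ≤ Π_{i : J_i = 0} w_{γ|A}(i)` — `norm_fibre_twist_le_junta` with the extra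
coordinate product `sgn_σ` absorbed into `Ψ₀`. -/
theorem norm_fibre_twist_le_junta_signed (hN : 3 ≤ N) {x₀ : Fin N → Bool} (hx₀ : Fib19.IsOdd x₀) (T : Fin N → Finset (Fin N))
    (y : Fin N → (Fin N → Bool) → Bool) (hy : ∀ k, ReadsOnly (T k) (y k)) (σ : Fin N → Bool)
    (γ : Fin N → ZMod 3) (A : Finset (Fin N)) (hA : ∀ k, (T k ∩ A).card ≤ 1) :
    ‖∑ x ∈ ((univ : Finset (Fin N → Bool)).filter fun x => Fib19.IsOdd x).filter
        (fun x => Fib19.kline x = Fib19.kline x₀),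
        (-1 : ℂ) ^ dot2 (Fib19.kline x) (Fib19.stake (fun x k => y k x) x) * SparseRead39.sgn σ x
          * (ZMod.stdAddChar (∑ i : Fin N, if x i then γ i else 0) : ℂ)‖
      ≤ wordWt (wtGamma (fun i => if i ∈ A then γ i else 0)) (Fib19.kline x₀) := by
  set J := Fib19.kline x₀ with hJ
  set γR : Fin N → ZMod 3 := fun i => if i ∈ A then γ i else 0 with hγR
  have hrw : ∑ x ∈ ((univ : Finset (Fin N → Bool)).filter fun x => Fib19.IsOdd x).filter (fun x => Fib19.kline x = J),
      (-1 : ℂ) ^ dot2 (Fib19.kline x) (Fib19.stake (fun x k => y k x) x) * SparseRead39.sgn σ x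
        * (ZMod.stdAddChar (∑ i : Fin N, if x i then γ i else 0) : ℂ)
      = ∑ x ∈ ((univ : Finset (Fin N → Bool)).filter fun x => Fib19.IsOdd x).filter (fun x => Fib19.kline x = J),
      (-1 : ℂ) ^ dot2 J (Fib19.stake (fun x k => y k x) x) * SparseRead39.sgn σ x
        * (ZMod.stdAddChar (∑ i : Fin N, if x i then γ i else 0) : ℂ) := by
    refine sum_congr rfl fun x hx => ?_
    rw [(mem_filter.mp hx).2]
  rw [hrw, sum_fibre_eq hN hx₀]
  -- the pieces on the fibre
  set S₀ : ({i // i ∉ act J} → Bool) → ℂ := fun v =>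
    ∏ b ∈ act J, (sgnB ((gv J v) b) * sgnB ((gv J v) (nxt b))) with hS₀
  set Q : ({i // i ∉ act J} → Bool) → ℂ := fun v => SparseRead39.sgn σ (gv J v) with hQ
  set h : Fin N → ({i // i ∉ act J} → Bool) → ℂ := fun b v => sgnB (y b (gv J v)) with hh
  set P : ({i // i ∉ act J} → Bool) → ℂ := fun v => ∏ i : Fin N, sgnB (!(gv J v) i) with hP
  have hS₀c : IsCoordProduct S₀ := isCoordProduct_fibreSign₀ J
  have hQc : IsCoordProduct Q := isCoordProduct_sgn_fibre J σ
  have hPc : IsCoordProduct P := isCoordProduct_zerosSign J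
  have hSQc : IsCoordProduct (fun v => S₀ v * Q v) := hS₀c.mul hQc
  have hPSQc : IsCoordProduct (fun v => P v * (S₀ v * Q v)) := hPc.mul hSQc
  have hpm : ∀ b ∈ act J, ∀ v, h b v = 1 ∨ h b v = -1 := fun b _ v => sgnB_cases _
  have hread : ∀ b ∈ act J, AffBells23.ReadsOn (coinSet J (T b)) (h b) :=
    fun b _ => readsOn_sgnB_junta J (T b) (y b) (hy b)
  have hA' : ∀ b ∈ act J, (coinSet J (T b) ∩ coinPre J A).card ≤ 1 :=
    fun b _ => card_coinSet_inter_le J (T b) A (hA b)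
  set cA : ℂ := (ZMod.stdAddChar (∑ k : {i // i ∈ act J}, if forced J k then γ k else 0) : ℂ) with hcA
  set γ' : {i // i ∉ act J} → ZMod 3 := fun k => γ k with hγ'
  have hterm : ∀ v : {i // i ∉ act J} → Bool,
      (if Fib19.IsOdd (gv J v) then (-1 : ℂ) ^ dot2 J (Fib19.stake (fun x k => y k x) (gv J v)) * SparseRead39.sgn σ (gv J v)
          * (ZMod.stdAddChar (∑ i : Fin N, if gv J v i then γ i else 0) : ℂ) else 0)
        = cA / 2 * (((S₀ v * Q v) * ∏ b ∈ act J, h b v) * (ZMod.stdAddChar (∑ k, if v k then γ' k else 0) : ℂ))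
          - cA / 2 * (((P v * (S₀ v * Q v)) * ∏ b ∈ act J, h b v)
              * (ZMod.stdAddChar (∑ k, if v k then γ' k else 0) : ℂ)) := by
    intro v
    have hind := isOdd_indicator_eq (gv J v)
    rw [char_split, AddChar.map_add_eq_mul, fibreSign_eq_prod]
    by_cases ho : Fib19.IsOdd (gv J v)
    · rw [if_pos ho] at hind ⊢
      have hP1 : P v = -1 := by
        have : (1 : ℂ) = (1 - P v) / 2 := hind
        linear_combination 2 * this
      rw [hP1]; simp only [hS₀, hh, hQ, hcA, hγ']; ring
    · rw [if_neg ho] at hind ⊢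
      have hP1 : P v = 1 := by
        have : (0 : ℂ) = (1 - P v) / 2 := hind
        linear_combination 2 * this
      rw [hP1]; ring
  rw [sum_congr rfl fun v _ => hterm v, sum_sub_distrib, ← mul_sum, ← mul_sum]
  have hB := AffBells23.norm_sum_juntaProduct_mul_char_le (act J) (fun b => coinSet J (T b)) h hpm hread hSQc γ'
    (coinPre J A) hA'
  have hB' := AffBells23.norm_sum_juntaProduct_mul_char_le (act J) (fun b => coinSet J (T b)) h hpm hread hPSQc γ'
    (coinPre J A) hA'
  have hcAn : ‖cA / 2‖ = 1 / 2 := by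
    rw [norm_div, hcA, AffBells21.norm_stdAddChar_three]; simp
  -- the product bound equals the word weight of the restricted frequency
  have hprod : ∏ k : {i // i ∉ act J}, (if k ∈ coinPre J A ∧ γ' k ≠ 0 then Real.sqrt 3 else 2) = wordWt (wtGamma γR) J := by
    have e1 : ∀ k : {i // i ∉ act J}, (if k ∈ coinPre J A ∧ γ' k ≠ 0 then Real.sqrt 3 else 2)
        = (fun i : Fin N => if γR i ≠ 0 then Real.sqrt 3 else 2) k := by
      intro k
      have hk : (k ∈ coinPre J A) ↔ k.val ∈ A := by simp [coinPre]
      simp only [hγR, hγ', hk]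
      by_cases hkA : k.val ∈ A
      · simp [hkA]
      · simp [hkA]
    rw [Fintype.prod_congr _ _ e1]
    unfold wordWt
    rw [← Finset.prod_subtype (p := fun i => i ∉ act J) (act J)ᶜ (fun _ => Finset.mem_compl)
      (f := fun i => if γR i ≠ 0 then Real.sqrt 3 else 2),
      ← Finset.prod_filter_mul_prod_filter_not univ (fun i => J i = false)]
    have h1 : (act J)ᶜ = (univ.filter fun i : Fin N => J i = false) := by
      ext i; simp [act]
    have h2 : ∏ i ∈ univ.filter (fun i : Fin N => ¬ J i = false),
        (if J i = false then wtGamma γR i.val else 1) = 1 :=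
      prod_eq_one fun i hi => by rw [if_neg (mem_filter.mp hi).2]
    rw [h1, h2, mul_one]
    refine prod_congr rfl fun i hi => ?_
    rw [if_pos (mem_filter.mp hi).2, wtGamma_val]
  calc ‖cA / 2 * ∑ v, ((S₀ v * Q v) * ∏ b ∈ act J, h b v) * (ZMod.stdAddChar (∑ k, if v k then γ' k else 0) : ℂ)
        - cA / 2 * ∑ v, ((P v * (S₀ v * Q v)) * ∏ b ∈ act J, h b v)
            * (ZMod.stdAddChar (∑ k, if v k then γ' k else 0) : ℂ)‖
      ≤ ‖cA / 2 * ∑ v, ((S₀ v * Q v) * ∏ b ∈ act J, h b v) * (ZMod.stdAddChar (∑ k, if v k then γ' k else 0) : ℂ)‖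
        + ‖cA / 2 * ∑ v, ((P v * (S₀ v * Q v)) * ∏ b ∈ act J, h b v)
            * (ZMod.stdAddChar (∑ k, if v k then γ' k else 0) : ℂ)‖ := norm_sub_le _ _
    _ ≤ 1 / 2 * wordWt (wtGamma γR) J + 1 / 2 * wordWt (wtGamma γR) J := by
        rw [norm_mul, norm_mul, hcAn, ← hprod]
        exact add_le_add (mul_le_mul_of_nonneg_left hB (by norm_num)) (mul_le_mul_of_nonneg_left hB' (by norm_num))
    _ = wordWt (wtGamma γR) J := by ring

/-! ## The signed frozen twist bound (sum over kernel lines) -/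

/-- **THE SIGNED FROZEN TWIST BOUND, JUNTA TABLES**: for frozen tables `y_k` reading `T_k`, a sign pattern `σ`, a frequency `γ` and a
transversal `A ⊆ supp γ` of `(T_k)`, `‖Σ_{x odd} (−1)^{⟨J(x), stake(y,x)⟩} sgn_σ(x) ω^{⟨γ,x⟩}‖ ≤ (200/39)·(39/40)^{|A|}·2^{N−1}`. -/
theorem norm_twist_sum_le_junta_signed (hN : 3 ≤ N) (T : Fin N → Finset (Fin N)) (y : Fin N → (Fin N → Bool) → Bool)
    (hy : ∀ k, ReadsOnly (T k) (y k)) (σ : Fin N → Bool) (γ : Fin N → ZMod 3) (A : Finset (Fin N))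
    (hA : ∀ k, (T k ∩ A).card ≤ 1) (hAγ : ∀ i ∈ A, γ i ≠ 0) :
    ‖∑ x ∈ (univ : Finset (Fin N → Bool)).filter (fun x => Fib19.IsOdd x),
        (-1 : ℂ) ^ dot2 (Fib19.kline x) (Fib19.stake (fun x k => y k x) x) * SparseRead39.sgn σ x
          * (ZMod.stdAddChar (∑ i : Fin N, if x i then γ i else 0) : ℂ)‖
      ≤ 200 / 39 * (39 / 40 : ℝ) ^ A.card * (2 : ℝ) ^ (N - 1) := by
  obtain ⟨m, rfl⟩ : ∃ m, N = m + 1 := ⟨N - 1, by omega⟩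
  set γR : Fin (m + 1) → ZMod 3 := fun i => if i ∈ A then γ i else 0 with hγR
  set O := (univ : Finset (Fin (m + 1) → Bool)).filter (fun x => Fib19.IsOdd x) with hO
  set Φ : (Fin (m + 1) → Bool) → ℂ := fun x => (-1 : ℂ) ^ dot2 (Fib19.kline x) (Fib19.stake (fun x k => y k x) x)
      * SparseRead39.sgn σ x * (ZMod.stdAddChar (∑ i : Fin (m + 1), if x i then γ i else 0) : ℂ) with hΦ
  have hmaps : ∀ x ∈ O, Fib19.kline x ∈ O.image Fib19.kline := fun x hx => mem_image_of_mem _ hx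
  rw [← sum_fiberwise_of_maps_to hmaps]
  have hfib : ∀ J ∈ O.image Fib19.kline,
      ‖∑ x ∈ O.filter (fun x => Fib19.kline x = J), Φ x‖ ≤ wordWt (wtGamma γR) J := by
    intro J hJ
    obtain ⟨x₀, hx₀, rfl⟩ := mem_image.mp hJ
    exact norm_fibre_twist_le_junta_signed hN (mem_filter.mp hx₀).2 T y hy σ γ A hA
  have hsub : O.image Fib19.kline ⊆ univ.filter (fun v : Fin (m + 1) → Bool => NoAdj v) := by
    intro J hJ
    obtain ⟨x₀, hx₀, rfl⟩ := mem_image.mp hJ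
    exact mem_filter.mpr ⟨mem_univ _, noAdj_of_hardCore (Fib19.kline_hardCore hN x₀ (mem_filter.mp hx₀).2)⟩
  set D := univ.filter fun i : Fin (m + 1) => γR i ≠ 0 with hD
  have hDA : D = A := by
    ext i
    simp only [hD, hγR, mem_filter, mem_univ, true_and]
    constructor
    · intro h
      by_contra hi
      exact h (by simp [hi])
    · intro hi
      simp [hi, hAγ i hi]
  have h3 := total_le_two_mixed (wtGamma γR) (wtGamma_nonneg γR) (wtGamma_le_two γR) (D.map Fin.valEmbedding)
    (fun i hi => wtGamma_le_of_mem γR i hi) m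
  have hκ := kappa_pow_le (card_supp_le_filter_succ D)
  rw [Nat.add_sub_cancel, ← hDA]
  have h2q : (0 : ℝ) ≤ 2 ^ m := by positivity
  calc ‖∑ J ∈ O.image Fib19.kline, ∑ x ∈ O.filter (fun x => Fib19.kline x = J), Φ x‖
      ≤ ∑ J ∈ O.image Fib19.kline, ‖∑ x ∈ O.filter (fun x => Fib19.kline x = J), Φ x‖ := norm_sum_le _ _
    _ ≤ ∑ J ∈ O.image Fib19.kline, wordWt (wtGamma γR) J := sum_le_sum hfib
    _ ≤ ∑ v : Fin (m + 1) → Bool, (if NoAdj v then wordWt (wtGamma γR) v else 0) := by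
        rw [← sum_filter]
        exact sum_le_sum_of_subset_of_nonneg hsub (fun v _ _ => wordWt_nonneg (wtGamma_nonneg γR) v)
    _ ≤ _ := h3
    _ ≤ 5 * ((40 / 39) * (39 / 40 : ℝ) ^ D.card) * 2 ^ m := by gcongr
    _ = 200 / 39 * (39 / 40 : ℝ) ^ D.card * 2 ^ m := by ring

/-! ## The signed strategy-free term and the signed transversal form of (R1) -/

/-- **The signed strategy-free term**: `‖Σ_{x odd} sgn_σ(x) e₃(β·x)‖ ≤ Π_i (β_i ≠ 0 ? √3 : 2)`. -/
theorem norm_oddClass_char_le_signed (σ : Fin N → Bool) (β : Fin N → ZMod 3) :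
    ‖∑ x ∈ (univ : Finset (Fin N → Bool)).filter (fun x => Fib19.IsOdd x),
        SparseRead39.sgn σ x * (ZMod.stdAddChar (∑ i : Fin N, if x i then β i else 0) : ℂ)‖
      ≤ ∏ i : Fin N, (if β i ≠ 0 then Real.sqrt 3 else 2) := by
  classical
  set χ : (Fin N → Bool) → ℂ := fun x => (ZMod.stdAddChar (∑ i : Fin N, if x i then β i else 0) : ℂ) with hχ
  set Q : (Fin N → Bool) → ℂ := fun x => SparseRead39.sgn σ x with hQ
  set P : (Fin N → Bool) → ℂ := fun x => ∏ i : Fin N, sgnB (!x i) with hP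
  have hrw : (∑ x ∈ (univ : Finset (Fin N → Bool)).filter (fun x => Fib19.IsOdd x), Q x * χ x)
      = ((∑ x : Fin N → Bool, Q x * χ x) - ∑ x : Fin N → Bool, (P x * Q x) * χ x) / 2 := by
    rw [sum_filter]
    have hterm : ∀ x : Fin N → Bool, (if Fib19.IsOdd x then Q x * χ x else 0) = (Q x * χ x - (P x * Q x) * χ x) / 2 := by
      intro x
      have h1 : (if Fib19.IsOdd x then Q x * χ x else 0) = (if Fib19.IsOdd x then (1 : ℂ) else 0) * (Q x * χ x) := by
        split_ifs <;> simp
      rw [h1, isOdd_indicator_eq]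
      ring
    rw [sum_congr rfl fun x _ => hterm x, ← sum_div, sum_sub_distrib]
  rw [hrw, norm_div, RCLike.norm_ofNat]
  have hQc : IsCoordProduct Q := isCoordProduct_sgn_cube σ
  have h1 := norm_sum_coordProduct_mul_char_le hQc β
  have h2 := norm_sum_coordProduct_mul_char_le ((isCoordProduct_zerosSign_cube (N := N)).mul hQc) β
  calc ‖(∑ x : Fin N → Bool, Q x * χ x) - ∑ x : Fin N → Bool, (P x * Q x) * χ x‖ / 2
      ≤ (‖∑ x : Fin N → Bool, Q x * χ x‖ + ‖∑ x : Fin N → Bool, (P x * Q x) * χ x‖) / 2 := by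
        gcongr; exact norm_sub_le _ _
    _ ≤ ((∏ i : Fin N, (if β i ≠ 0 then Real.sqrt 3 else 2)) + ∏ i : Fin N, (if β i ≠ 0 then Real.sqrt 3 else 2)) / 2 := by
        gcongr
    _ = ∏ i : Fin N, (if β i ≠ 0 then Real.sqrt 3 else 2) := by ring

/-- Each term of a signed twisted win sum has norm `≤ 1`, so the sum is trivially `≤ 2^N`. -/
theorem norm_twistedWinSum_le_trivial_signed (β : Fin N → ZMod 3) (σ : Fin N → Bool) (g : Fin N → (Fin N → Bool) → Bool) :
    ‖∑ x : Fin N → Bool, (ZMod.stdAddChar (∑ i : Fin N, if x i then β i else 0) : ℂ) * SparseRead39.sgn σ x *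
        (if (OddZeros x ∧ RingHLF.Rel x (fun k => g k x)) then (1 : ℂ) else 0)‖ ≤ (2 : ℝ) ^ N := by
  classical
  refine (norm_sum_le _ _).trans ?_
  calc ∑ x : Fin N → Bool, ‖(ZMod.stdAddChar (∑ i : Fin N, if x i then β i else 0) : ℂ) * SparseRead39.sgn σ x *
          (if (OddZeros x ∧ RingHLF.Rel x (fun k => g k x)) then (1 : ℂ) else 0)‖
      ≤ ∑ _x : Fin N → Bool, (1 : ℝ) := by
        refine sum_le_sum fun x _ => ?_
        rw [norm_mul, norm_mul, AffBells21.norm_stdAddChar_three, norm_sgn, one_mul, one_mul]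
        split_ifs <;> simp
    _ = (2 : ℝ) ^ N := by simp

/-- **THE SIGNED TRANSVERSAL FORM OF (R1)** (kernel-line fibre method).  If bell `k` reads only the letters in `T k` and `A ⊆ supp β` is a
TRANSVERSAL of the reading sets (`#(T k ∩ A) ≤ 1`), then for every sign pattern `σ`,
`‖Σ_x e₃(β·x)·(−1)^{Σ_{i ∈ σ} x_i}·[OddZeros x ∧ Rel x (g x)]‖ ≤ 2·(39/40)^{#A}·2^N` (`N ≥ 3`). -/
theorem norm_twistedWinSum_le_of_transversal_signed (hN : 3 ≤ N) (T : Fin N → Finset (Fin N))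
    (g : Fin N → (Fin N → Bool) → Bool) (hg : ∀ k, ReadsOnly (T k) (g k)) (σ : Fin N → Bool) (β : Fin N → ZMod 3)
    (A : Finset (Fin N)) (hA : ∀ k, (T k ∩ A).card ≤ 1) (hAβ : ∀ i ∈ A, β i ≠ 0) :
    ‖∑ x : Fin N → Bool, (ZMod.stdAddChar (∑ i : Fin N, if x i then β i else 0) : ℂ) * SparseRead39.sgn σ x *
        (if (OddZeros x ∧ RingHLF.Rel x (fun k => g k x)) then (1 : ℂ) else 0)‖
      ≤ 2 * (39 / 40 : ℝ) ^ A.card * (2 : ℝ) ^ N := by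
  classical
  set χ : (Fin N → Bool) → ℂ := fun x => (ZMod.stdAddChar (∑ i : Fin N, if x i then β i else 0) : ℂ) with hχ
  set Q : (Fin N → Bool) → ℂ := fun x => SparseRead39.sgn σ x with hQ
  set s : (Fin N → Bool) → ℂ := fun x =>
    (-1 : ℂ) ^ dot2 (Fib19.kline x) (Fib19.stake (fun x k => g k x) x) with hs
  set O := (univ : Finset (Fin N → Bool)).filter (fun x => Fib19.IsOdd x) with hO
  -- pointwise: `e₃(β·x)·sgn·[odd ∧ WIN] = [odd]·(sgn·e₃ − s·sgn·e₃)/2`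
  have hterm : ∀ x : Fin N → Bool,
      χ x * Q x * (if (OddZeros x ∧ RingHLF.Rel x (fun k => g k x)) then (1 : ℂ) else 0)
        = if Fib19.IsOdd x then (Q x * χ x - s x * Q x * χ x) / 2 else 0 := by
    intro x
    by_cases hx : Fib19.IsOdd x
    · have hox : OddZeros x := (Fib19.isOdd_iff_oddZeros x).mp hx
      rw [if_pos hx]
      have hw := win_indicator_eq hN (fun x k => g k x) x hx
      have e : (if (OddZeros x ∧ RingHLF.Rel x (fun k => g k x)) then (1 : ℂ) else 0)
          = (if RingHLF.Rel x ((fun x k => g k x) x) then (1 : ℂ) else 0) := by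
        simp only [hox, true_and]
      rw [e, hw]
      ring
    · have hox : ¬ OddZeros x := fun h => hx ((Fib19.isOdd_iff_oddZeros x).mpr h)
      rw [if_neg hx, if_neg (fun h => hox h.1), mul_zero]
  have hsplit : (∑ x : Fin N → Bool, χ x * Q x * (if (OddZeros x ∧ RingHLF.Rel x (fun k => g k x)) then (1 : ℂ) else 0))
      = ((∑ x ∈ O, Q x * χ x) - ∑ x ∈ O, s x * Q x * χ x) / 2 := by
    rw [sum_congr rfl fun x _ => hterm x, ← sum_filter, ← sum_div, sum_sub_distrib]
  rw [hsplit, norm_div, RCLike.norm_ofNat]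
  -- the two terms
  have h1 : ‖∑ x ∈ O, Q x * χ x‖ ≤ (39 / 40 : ℝ) ^ A.card * (2 : ℝ) ^ N := by
    refine ((norm_oddClass_char_le_signed σ β).trans (prod_wt_le_pow β)).trans ?_
    have hAsub : A ⊆ univ.filter (fun i : Fin N => β i ≠ 0) := fun i hi => mem_filter.mpr ⟨mem_univ _, hAβ i hi⟩
    have hcard : A.card ≤ (univ.filter fun i : Fin N => β i ≠ 0).card := card_le_card hAsub
    have hpow : (39 / 40 : ℝ) ^ (univ.filter fun i : Fin N => β i ≠ 0).card ≤ (39 / 40 : ℝ) ^ A.card :=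
      pow_le_pow_of_le_one (by norm_num) (by norm_num) hcard
    exact mul_le_mul_of_nonneg_right hpow (by positivity)
  have h2 : ‖∑ x ∈ O, s x * Q x * χ x‖ ≤ 200 / 39 * (39 / 40 : ℝ) ^ A.card * (2 : ℝ) ^ (N - 1) :=
    norm_twist_sum_le_junta_signed hN T g hg σ β A hA hAβ
  have h2N : (2 : ℝ) ^ (N - 1) = 2 ^ N / 2 := by
    obtain ⟨m, rfl⟩ : ∃ m, N = m + 1 := ⟨N - 1, by omega⟩
    rw [Nat.add_sub_cancel, pow_succ]; ring
  rw [h2N] at h2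
  have hpos : (0 : ℝ) ≤ (39 / 40 : ℝ) ^ A.card * (2 : ℝ) ^ N := by positivity
  calc ‖(∑ x ∈ O, Q x * χ x) - ∑ x ∈ O, s x * Q x * χ x‖ / 2
      ≤ (‖∑ x ∈ O, Q x * χ x‖ + ‖∑ x ∈ O, s x * Q x * χ x‖) / 2 := by gcongr; exact norm_sub_le _ _
    _ ≤ ((39 / 40 : ℝ) ^ A.card * (2 : ℝ) ^ N + 200 / 39 * (39 / 40 : ℝ) ^ A.card * (2 ^ N / 2)) / 2 := by gcongr
    _ ≤ 2 * (39 / 40 : ℝ) ^ A.card * (2 : ℝ) ^ N := by nlinarith [hpos]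

end AffBells22

/-! ## The typed targets of `SparseRead39.lean` (ROUND-38 §6.4.2, ask A39-6) -/

namespace SparseRead39

open AffBells22

variable {N : ℕ}

/-- The signed transversal form in the `twSum` vocabulary: `‖twSum β σ g‖ ≤ 2·(39/40)^{#A}·2^N` for every transversal `A ⊆ supp β` of
the reading sets of `g` (`N ≥ 3`). -/
theorem norm_twSum_le_of_transversal (hN : 3 ≤ N) (T : Fin N → Finset (Fin N)) (g : Fin N → (Fin N → Bool) → Bool)
    (hg : ∀ k, ReadsOnly (T k) (g k)) (σ : Fin N → Bool) (β : Fin N → ZMod 3) (A : Finset (Fin N))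
    (hA : ∀ k, (T k ∩ A).card ≤ 1) (hAβ : ∀ i ∈ A, β i ≠ 0) :
    ‖twSum β σ g‖ ≤ 2 * (39 / 40 : ℝ) ^ A.card * (2 : ℝ) ^ N := by
  unfold twSum phase ind; exact norm_twistedWinSum_le_of_transversal_signed hN T g hg σ β A hA hAβ

/-- The trivial bound `‖twSum β σ g‖ ≤ 2^N`. -/
theorem norm_twSum_le_trivial (β : Fin N → ZMod 3) (σ : Fin N → Bool) (g : Fin N → (Fin N → Bool) → Bool) :
    ‖twSum β σ g‖ ≤ (2 : ℝ) ^ N := by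
  unfold twSum phase ind; exact norm_twistedWinSum_le_trivial_signed β σ g

/-- **`TwistBoundZConstPM (39/40)` PROVED** (constant `A = 2`): constant-output strategies, twisted by `e₃(β·x)` AND an arbitrary real sign
character, have `‖twSum β σ b‖ ≤ 2·(39/40)^{#supp β}·2^N` (transversal `A = supp β` of the empty reading sets; `N ≤ 2` trivially). -/
theorem twistBoundZConstPM : TwistBoundZConstPM (39 / 40 : ℝ) := by
  refine ⟨2, fun N b σ β => ?_⟩
  set A := univ.filter (fun j : Fin N => β j ≠ 0) with hAdef
  have hwt : wt β = A.card := rfl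
  rw [hwt]
  by_cases hN : 3 ≤ N
  · have hT : ∀ k : Fin N, ReadsOnly (∅ : Finset (Fin N)) (fun _ : Fin N → Bool => b k) := fun _ _ _ _ => rfl
    have hA : ∀ k : Fin N, ((∅ : Finset (Fin N)) ∩ A).card ≤ 1 := fun k => by simp
    have hAβ : ∀ j ∈ A, β j ≠ 0 := fun j hj => (mem_filter.mp hj).2
    exact norm_twSum_le_of_transversal hN (fun _ => ∅) (fun k _ => b k) hT σ β A hA hAβ
  · refine (norm_twSum_le_trivial β σ (fun k _ => b k)).trans ?_
    have hcard : A.card ≤ 2 := (card_filter_le _ _).trans (by rw [card_univ, Fintype.card_fin]; omega)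
    have hpow : (39 / 40 : ℝ) ^ 2 ≤ (39 / 40 : ℝ) ^ A.card := pow_le_pow_of_le_one (by norm_num) (by norm_num) hcard
    have h2 : (0 : ℝ) ≤ (2 : ℝ) ^ N := by positivity
    nlinarith [hpow, h2]

/-- **`TwistBoundZConstPMWeak (39/40)` PROVED** (rate only on the sign-free twisted letters; weaker). -/
theorem twistBoundZConstPMWeak : TwistBoundZConstPMWeak (39 / 40 : ℝ) :=
  strong_imp_weak (by norm_num) (by norm_num) twistBoundZConstPM

/-- **The sparse-reading rung `SparseReadTwistBound (39/40)` PROVED**: for every strategy determined by the letters in `R`,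
`‖Σ_x e₃(β·x)·[OddZeros x ∧ Rel x (g x)]‖ ≤ 2·2^{#R}·(39/40)^{#supp β}·2^N` — strategies reading fewer than `log₂(40/39)·#supp β`
letters IN TOTAL are exponentially beaten (planner p1 g39's reading of ROUND-38 §6.4.2). -/
theorem sparseReadTwistBound : SparseReadTwistBound (39 / 40 : ℝ) := sparseRead_of_pm twistBoundZConstPM

/-- **The (R1)-shaped sparse-reading rung `SparseReadTwistBoundOff (39/40)` PROVED.** -/
theorem sparseReadTwistBoundOff : SparseReadTwistBoundOff (39 / 40 : ℝ) :=
  sparseReadOff_of_pm (by norm_num) (by norm_num) twistBoundZConstPM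

/-- **Signed `(R1)₀` WITHOUT the `2^{#R}` loss**: a strategy determined by the letters of `R` obeys, for every sign pattern `σ`,
`‖twSum β σ g‖ ≤ 2·(39/40)^{#{i ∉ R : β_i ≠ 0}}·2^N` (transversal `A = supp β ∖ R` of the reading sets `T k = R`). -/
theorem norm_twSum_le_of_determined_sharp (R : Finset (Fin N)) (g : Fin N → (Fin N → Bool) → Bool)
    (hg : ∀ k (x x' : Fin N → Bool), (∀ i ∈ R, x i = x' i) → g k x = g k x') (σ : Fin N → Bool) (β : Fin N → ZMod 3) :
    ‖twSum β σ g‖ ≤ 2 * (39 / 40 : ℝ) ^ (univ.filter fun i : Fin N => i ∉ R ∧ β i ≠ 0).card * (2 : ℝ) ^ N := by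
  set A := univ.filter (fun j : Fin N => j ∉ R ∧ β j ≠ 0) with hAdef
  by_cases hN : 3 ≤ N
  · have hT : ∀ k, ReadsOnly R (g k) := fun k x x' h => hg k x x' h
    have hA : ∀ k : Fin N, (R ∩ A).card ≤ 1 := by
      intro k
      rw [Finset.card_le_one]
      intro a ha b _
      exact absurd (mem_inter.mp ha).1 (mem_filter.mp (mem_inter.mp ha).2).2.1
    have hAβ : ∀ j ∈ A, β j ≠ 0 := fun j hj => (mem_filter.mp hj).2.2
    exact norm_twSum_le_of_transversal hN (fun _ => R) g hT σ β A hA hAβ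
  · refine (norm_twSum_le_trivial β σ g).trans ?_
    have hcard : A.card ≤ 2 := (card_filter_le _ _).trans (by rw [card_univ, Fintype.card_fin]; omega)
    have hpow : (39 / 40 : ℝ) ^ 2 ≤ (39 / 40 : ℝ) ^ A.card := pow_le_pow_of_le_one (by norm_num) (by norm_num) hcard
    have h2 : (0 : ℝ) ≤ (2 : ℝ) ^ N := by positivity
    nlinarith [hpow, h2]

end SparseRead39

end Summit.QuantumAdvantage.AdviceFreeQNC0

end
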